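import Literature.NumberTheory.EllipticCurves.DeShalit1987.KatzBranchRigidity
import HarnessLib

/-!
# STUB-IDEAS k3·g5 — `stub_heegnerIndexLowerAtTwo` (crux `PrintCf2.SplitBadTwoLowerHalfOfFacts`,
# stmt-BirchSwinnertonDyer-27851): the Δ-BRANCH of T3 (k3-g3 `stub_packageDeltaBranch_two`) DECOMPOSED
# AT FINITE LEVEL — "CH18 Thm 4.8 at p = 2, r = 1, j = 0, n ∈ {2, 3}"

Stub-ideation sketch (seat k = 3, gen 5, TECHNIQUE = decomposition).  **BSD is NOT proved by any of this**;
nothing here proves the stub, the crux, S2′ or T3.  What is kernel-checked: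

* §A the dyadic character tables `χ₋₄, χ₈, χ₋₈` (= the local components `φ_{δ,v}`, `δ = −1, 2, −2`), their
  primitivity and the two "V-term cancellations" that Castella–Hsieh's proof of Thm 4.8 uses under the
  hypothesis "exact conductor `p^n`, `n ≥ 2`" (arXiv:1505.08165 p. 16, display after (eq:bdp)); the conductor
  exponents `n(δ) = 2, 3, 3` (all `≥ 2`);
* §B "the torsion of `Γ̃ ≅ ℤ₂^× = {±1} × (1+4ℤ₂)` costs nothing": evaluation at the two characters of `C₂`
  is injective on `R[C₂]` as soon as `2` is (left-)regular in `R` (so identities of `𝒪⟦Γ̃⟧`-measures are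
  decided componentwise, no idempotent `(1 ± σ)/2`); units of `𝒪_{ℂ₂}⟦T⟧` have constant term of norm `1`;
* §C the five sub-stubs S1–S5 of the decomposition as `Prop`s in S2′'s value currency and the PROVED glue
  `S3 ∧ S5 ⟹ (W-b)`, `S4 ⟹ (W-a)` with `ε = n(δ) + 2c₀`, `S2 ⟹ (W-c)` with `ρ = n(δ) + 2c₁`, hence
  k3-g3's analytic triple `(W-a) ∧ (W-b) ∧ (W-c)` at `φ_δ`, and the explicit column `2ε − ρ = n(δ) + 4c₀ − 2c₁`;
* §D the ONE-SIDED (LOWER) form: `S3⁻` ("the Katz product is divisible by the BDP square on the line") +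
  `S4⁻` + `S2` + `S5` ⟹ `m ≥ n(δ) + 4c₀ − 2c₁ − 2a + 4k + 4ℓ` (the `a` cancels downstream against (W-d), as in
  k3-g3), proved from `norm` bookkeeping in `ℂ_[2]`.

Research content is NOT typed as `sorry`d theorems over fake carriers (B12): S1/S4 are stated in the card as
definition requests (`IsCMSumBranchTwo`) + informal signatures; here they enter only through their VALUE-level
consequences (`PadicGZAtPhi`, `FactorisationOnLine`, …), exactly as k3-g3's (W-a)–(W-e) did.
-/

noncomputable section

set_option linter.dupNamespace false

open scoped Classical

namespace Summit.BirchSwinnertonDyer.BirchSwinnertonDyer.Cruxes.SplitBadTwoLowerHalfOfFacts.HeegnerIndexTwo.K3G5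

open Literature.NumberTheory.EllipticCurves

/-! ### §A  Dyadic characters `φ_{δ,v}`: tables, primitivity, conductor exponents, V-term cancellation (PROVED) -/

/-- `χ₋₄` on `ℤ/4` (extended by `0` off the units): the local component at `v` of `φ₋₁ = χ₋₁ ∘ N`
(keys `(1,3),(1,7)`, `δ = −1`, conductor exponent `n = 2`). -/
def chi4m (u : ZMod 4) : ℤ := if u = 1 then 1 else if u = 3 then -1 else 0

/-- `χ₈` on `ℤ/8`: local component of `φ₂ = χ₂ ∘ N` (keys `(0,1),(0,5)`, `δ = 2`, `n = 3`). -/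
def chi8p (u : ZMod 8) : ℤ := if u = 1 ∨ u = 7 then 1 else if u = 3 ∨ u = 5 then -1 else 0

/-- `χ₋₈` on `ℤ/8`: local component of `φ₋₂ = χ₋₂ ∘ N` (keys `(0,3),(0,7)`, `δ = −2`, `n = 3`). -/
def chi8m (u : ZMod 8) : ℤ := if u = 1 ∨ u = 3 then 1 else if u = 5 ∨ u = 7 then -1 else 0

/-- Sum over `(ℤ/4)^× = {1, 3}`. -/
def unitSum4 (χ h : ZMod 4 → ℤ) : ℤ := χ 1 * h 1 + χ 3 * h 3

/-- Sum over `(ℤ/8)^× = {1, 3, 5, 7}`. -/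
def unitSum8 (χ h : ZMod 8 → ℤ) : ℤ := χ 1 * h 1 + χ 3 * h 3 + χ 5 * h 5 + χ 7 * h 7

@[simp] theorem chi4m_one : chi4m 1 = 1 := by decide
@[simp] theorem chi4m_three : chi4m 3 = -1 := by decide
@[simp] theorem chi8p_one : chi8p 1 = 1 := by decide
@[simp] theorem chi8p_three : chi8p 3 = -1 := by decide
@[simp] theorem chi8p_five : chi8p 5 = -1 := by decide
@[simp] theorem chi8p_seven : chi8p 7 = 1 := by decide
@[simp] theorem chi8m_one : chi8m 1 = 1 := by decide
@[simp] theorem chi8m_three : chi8m 3 = 1 := by decide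
@[simp] theorem chi8m_five : chi8m 5 = -1 := by decide
@[simp] theorem chi8m_seven : chi8m 7 = -1 := by decide

/-- Primitivity (character sums vanish): the `n − 2` V-term `p^{2j+1}·z_{𝔞𝒪_{c p^{n−2}}}` for `n = 2`
(a constant over `(ℤ/4)^×`) cancels. -/
theorem vterm2_cancel_chi4m (c : ℤ) : unitSum4 chi4m (fun _ ↦ c) = 0 := by
  simp [unitSum4]

/-- The `n − 1` V-term for `n = 2`: `h` factors through `ℤ/2`, i.e. `h (u + 2) = h u`. -/
theorem vterm1_cancel_chi4m (h : ZMod 4 → ℤ) (hper : ∀ u, h (u + 2) = h u) : unitSum4 chi4m h = 0 := by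
  have h3 : h 3 = h 1 := by
    have := hper 1
    rwa [show (1 : ZMod 4) + 2 = 3 from by decide] at this
  simp [unitSum4, h3]

/-- The `n − 1` V-term for `n = 3`, `χ₈`: `h` factors through `ℤ/4` (`h (u + 4) = h u`). -/
theorem vterm1_cancel_chi8p (h : ZMod 8 → ℤ) (hper : ∀ u, h (u + 4) = h u) : unitSum8 chi8p h = 0 := by
  have h5 : h 5 = h 1 := by
    have := hper 1
    rwa [show (1 : ZMod 8) + 4 = 5 from by decide] at this
  have h7 : h 7 = h 3 := by
    have := hper 3
    rwa [show (3 : ZMod 8) + 4 = 7 from by decide] at this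
  simp [unitSum8, h5, h7]

/-- The `n − 2` V-term for `n = 3`, `χ₈`: `h` factors through `ℤ/2` (`h (u + 2) = h u`). -/
theorem vterm2_cancel_chi8p (h : ZMod 8 → ℤ) (hper : ∀ u, h (u + 2) = h u) : unitSum8 chi8p h = 0 := by
  have h3 : h 3 = h 1 := by
    have := hper 1
    rwa [show (1 : ZMod 8) + 2 = 3 from by decide] at this
  have h5 : h 5 = h 3 := by
    have := hper 3
    rwa [show (3 : ZMod 8) + 2 = 5 from by decide] at this
  have h7 : h 7 = h 5 := by
    have := hper 5
    rwa [show (5 : ZMod 8) + 2 = 7 from by decide] at this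
  simp [unitSum8, h3, h5, h7]

/-- The `n − 1` V-term for `n = 3`, `χ₋₈`. -/
theorem vterm1_cancel_chi8m (h : ZMod 8 → ℤ) (hper : ∀ u, h (u + 4) = h u) : unitSum8 chi8m h = 0 := by
  have h5 : h 5 = h 1 := by
    have := hper 1
    rwa [show (1 : ZMod 8) + 4 = 5 from by decide] at this
  have h7 : h 7 = h 3 := by
    have := hper 3
    rwa [show (3 : ZMod 8) + 4 = 7 from by decide] at this
  simp [unitSum8, h5, h7]

/-- The `n − 2` V-term for `n = 3`, `χ₋₈`. -/
theorem vterm2_cancel_chi8m (h : ZMod 8 → ℤ) (hper : ∀ u, h (u + 2) = h u) : unitSum8 chi8m h = 0 := by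
  have h3 : h 3 = h 1 := by
    have := hper 1
    rwa [show (1 : ZMod 8) + 2 = 3 from by decide] at this
  have h5 : h 5 = h 3 := by
    have := hper 3
    rwa [show (3 : ZMod 8) + 2 = 5 from by decide] at this
  have h7 : h 7 = h 5 := by
    have := hper 5
    rwa [show (5 : ZMod 8) + 2 = 7 from by decide] at this
  simp [unitSum8, h3, h5, h7]

/-- `χ₋₄` is NOT killed by `h` through `ℤ/4` only up to `ℤ/2`: with `n = 1` (a character of conductor `2`,
which does not occur here) the first V-term would SURVIVE — this is CH18's hypothesis `n ≥ 2` (for `n = 1`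
the term `a_p(f)·z` stays).  Recorded as the non-example: for `h = chi4m` itself the sum is `2 ≠ 0`. -/
theorem vterm_survives_at_conductor_two : unitSum4 chi4m chi4m = 2 := by decide

/-- Conductor exponent `n(key)` of `φ_{δ,v}` as a function of `a = d % 2` (`a = 1`: `d` odd, `δ = −1`, `n = 2`;
`a = 0`: `d ≡ 2 (4)`, `δ = ±2`, `n = 3`).  `ord₂ 𝔤(φ_{δ,v}) = n/2` since `|𝔤|² = 2^n`. -/
def condExp (a : ℤ) : ℕ := if a = 1 then 2 else 3

@[simp] theorem condExp_one : condExp 1 = 2 := by simp [condExp]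
@[simp] theorem condExp_zero : condExp 0 = 3 := by simp [condExp]

/-- CH18 Thm 4.8's standing hypothesis `n ≥ 2` holds on all six keys. -/
theorem two_le_condExp (a : ℤ) : 2 ≤ condExp a := by
  unfold condExp; split <;> omega

/-! ### §B  Torsion of `Γ̃` and units (PROVED) -/

/-- **Evaluation at the two characters of `C₂` is injective when `2` is left-regular.**  An element
`a + bσ ∈ R[C₂]` (`σ² = 1`) is determined by `(a + b, a − b)`; so two `R`-valued measures on
`Γ̃ = {±1} × Γ⁻` (elements of `R[C₂]`, `R = 𝒪⟦Γ⁻⟧`) agreeing at all characters of BOTH signs are equal — no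
idempotent `(1 ± σ)/2 ∉ R[C₂]` is needed.  This is the precise sense in which "`#Γ̃_tors = 2 = p`" is harmless
for EVALUATING and IDENTIFYING measures (k3-g3·Δ / STUB-PLAN row k3-g3·Δ, B1′). -/
theorem signEval_injective {R : Type*} [CommRing R] (h2 : IsLeftRegular (2 : R))
    {a b a' b' : R} (hp : a + b = a' + b') (hm : a - b = a' - b') : a = a' ∧ b = b' := by
  have ha : (2 : R) * a = 2 * a' := by linear_combination hp + hm
  have hb : (2 : R) * b = 2 * b' := by linear_combination hp - hm
  exact ⟨h2 ha, h2 hb⟩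

/-- The same over any ring without zero divisors in which `2 ≠ 0` (e.g. `𝒪_{ℂ₂}⟦T⟧`). -/
theorem signEval_injective_of_two_ne_zero {R : Type*} [CommRing R] [NoZeroDivisors R] (h2 : (2 : R) ≠ 0)
    {a b a' b' : R} (hp : a + b = a' + b') (hm : a - b = a' - b') : a = a' ∧ b = b' :=
  signEval_injective (IsRegular.of_ne_zero' h2).left hp hm

/-- `(1, −1)`-difference: the two sign-components of `a + bσ` are CONGRUENT mod `2`:
`(a + b) − (a − b) = 2b`.  (The "mod-2 shadow" of §5 of the card: Δ-values and Γ-type values of the same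
pair at the same `Γ⁻`-point are congruent mod `2𝒪`.) -/
theorem signEval_sub_eq_two_mul {R : Type*} [CommRing R] (a b : R) : (a + b) - (a - b) = 2 * b := by ring

/-- Units of `𝒪_{ℂ₂}⟦T⟧` have constant term of norm `1` (tree: `isUnit_padicComplexInt_iff`). -/
theorem norm_constantCoeff_eq_one_of_isUnit {u : PowerSeries (PadicComplexInt 2)} (hu : IsUnit u) :
    ‖((PowerSeries.constantCoeff u : PadicComplexInt 2) : ℂ_[2])‖ = 1 :=
  isUnit_padicComplexInt_iff.mp (hu.map PowerSeries.constantCoeff)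

/-! ### §C  The sub-stubs S1–S5 in VALUE currency and the PROVED glue to k3-g3's (W-a), (W-b), (W-c) -/

/-- k3-g3 (W-a), restated verbatim: `‖Lf‖ = 2^{−ε/2 − k − ℓ}`. -/
def ERLAtPhi (Lf : ℂ_[2]) (ε k ℓ : ℤ) : Prop := ‖Lf‖ = (2 : ℝ) ^ (-(ε : ℝ) / 2 - k - ℓ)

/-- k3-g3 (W-b), restated verbatim: `Lf² = u·G0·Lin`, `‖u‖ = 1`. -/
def FactorisationAtPhi (G0 Lf Lin : ℂ_[2]) : Prop := ∃ u : ℂ_[2], ‖u‖ = 1 ∧ Lf ^ 2 = u * G0 * Lin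

/-- k3-g3 (W-c), restated verbatim: `‖Lin‖ = 2^{−ρ/2 − a}`. -/
def InRangeAtPhi (Lin : ℂ_[2]) (ρ a : ℤ) : Prop := ‖Lin‖ = (2 : ℝ) ^ (-(ρ : ℝ) / 2 - a)

/-- The constant term of a branch, read in `ℂ_[2]`. -/
def cc (F : PowerSeries (PadicComplexInt 2)) : ℂ_[2] := ((PowerSeries.constantCoeff F : PadicComplexInt 2) : ℂ_[2])

theorem cc_mul (F G : PowerSeries (PadicComplexInt 2)) : cc (F * G) = cc F * cc G := by
  simp [cc, map_mul]

theorem cc_pow (F : PowerSeries (PadicComplexInt 2)) (m : ℕ) : cc (F ^ m) = cc F ^ m := by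
  simp [cc, map_pow]

theorem norm_cc_le_one (F : PowerSeries (PadicComplexInt 2)) : ‖cc F‖ ≤ 1 :=
  norm_coe_padicComplexInt_le_one _

/-- **S3 (factorisation ON THE LINE).**  `L, Ga, Gb ∈ 𝒪_{ℂ₂}⟦T⟧` = the CM-sum branch of the good pair along the
`Γ⁻`-line through the `φ_δ`-point and the two Katz lines through `ψ₀*χ'*`, `ψ₀χ'*`; `L² = u·Ga·Gb` with `u` a UNIT
power series.  Engine: in-range agreement (S1 ∧ S2) + the tree's identity principle
`IntSeries.eq_of_infinite_hasValueAt_eq` / `IsKatzBranch.eq_of_infinite_range`. -/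
def FactorisationOnLine (L Ga Gb : PowerSeries (PadicComplexInt 2)) : Prop :=
  ∃ u : PowerSeries (PadicComplexInt 2), IsUnit u ∧ L ^ 2 = u * Ga * Gb

/-- **S3⁻ (what LOWER consumes): the Katz product is DIVISIBLE by the BDP square on the line.** -/
def DivisibilityOnLine (L Ga Gb : PowerSeries (PadicComplexInt 2)) : Prop :=
  ∃ w : PowerSeries (PadicComplexInt 2), Ga * Gb = w * L ^ 2

/-- **S5 (P-match).**  The Katz line `Ga` through the member's character and S2′'s own branch `G` are two
restrictions of ONE two-variable measure: `Ga(0) = w·G0` with `w` a NAMED unit (period-pair conversion). -/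
def MatchAtZero (Ga : PowerSeries (PadicComplexInt 2)) (G0 : ℂ_[2]) : Prop :=
  ∃ w : PadicComplexInt 2, IsUnit w ∧ cc Ga = (w : ℂ_[2]) * G0

/-- **S4 (CH18 Thm 4.8 at `p = 2`, `r = 1`, `j = 0`, conductor `2^n`, `n ∈ {2,3}`), value currency.**
`ord₂ L(0) = n/2 + c₀ + k + ℓ`: `n/2 = ord₂ 𝔤(φ_{δ,v}⁻¹)`; in CH18's own normalisation (proof of Thm 4.8,
second display at `j = 0`, `r₁ = 0`: prefactor `𝔤(ξ_v⁻¹)·2^{−n}·χ'_v(2^n)` against the TRACE class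
`z_{f,χ'} = cor_{K[c2^n]/K}`) one takes `c₀ := −n`, so `ord₂ L(0) = −n/2 + (k + ℓ)` with
`k + ℓ := ord₂ ⟨log_v z_{f,χ'}, ω_f⟩ ≥ n/2` (the trace class carries the index `[K[c2^n]:K[c]] = 2^{n−1}` inside
the Heegner multiplier `κ`, i.e. inside `k`); only the SUM of the analytic digit and `κ`'s `n`-dependence is
convention-free.  `c₀` is a free parameter of this `Prop`. -/
def PadicGZAtPhi (L : PowerSeries (PadicComplexInt 2)) (n : ℕ) (c₀ k ℓ : ℤ) : Prop :=
  ‖cc L‖ = (2 : ℝ) ^ (-(n : ℝ) / 2 - c₀ - k - ℓ)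

/-- **S4⁻**: the one-sided form LOWER needs (`L(0)` at least as divisible as `𝔤 · log²`). -/
def PadicGZLowerAtPhi (L : PowerSeries (PadicComplexInt 2)) (n : ℕ) (c₀ k ℓ : ℤ) : Prop :=
  ‖cc L‖ ≤ (2 : ℝ) ^ (-(n : ℝ) / 2 - c₀ - k - ℓ)

/-- **S2 (Katz in range at the partner's point, de Shalit II.4.14 at `2` — tree `IsKatzBranch`).**
`ord₂ Gb(0) = n/2 + c₁ + a` (`n/2` = local Gauss sum of the `v̄`-ramified character, `a` = the partner's
algebraic central value). -/
def KatzInRangeAtZero (Gb : PowerSeries (PadicComplexInt 2)) (n : ℕ) (c₁ a : ℤ) : Prop :=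
  ‖cc Gb‖ = (2 : ℝ) ^ (-(n : ℝ) / 2 - c₁ - a)

variable {L Ga Gb : PowerSeries (PadicComplexInt 2)} {G0 : ℂ_[2]} {n : ℕ} {c₀ c₁ k ℓ a : ℤ}

/-- **Glue 1: S3 ∧ S5 ⟹ (W-b).**  The unit is `cc u · w`, a NAMED product of two units. -/
theorem factorisationAtPhi_of_line (h3 : FactorisationOnLine L Ga Gb) (h5 : MatchAtZero Ga G0) :
    FactorisationAtPhi G0 (cc L) (cc Gb) := by
  obtain ⟨u, hu, hL⟩ := h3
  obtain ⟨w, hw, hGa⟩ := h5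
  refine ⟨cc u * (w : ℂ_[2]), ?_, ?_⟩
  · rw [norm_mul, cc, norm_constantCoeff_eq_one_of_isUnit hu, isUnit_padicComplexInt_iff.mp hw, one_mul]
  · have h := congrArg cc hL
    rw [cc_pow, cc_mul, cc_mul, hGa] at h
    rw [h]; ring

/-- **Glue 2: S4 ⟹ (W-a)** with `ε := n + 2c₀`. -/
theorem erlAtPhi_of_padicGZ (h4 : PadicGZAtPhi L n c₀ k ℓ) : ERLAtPhi (cc L) ((n : ℤ) + 2 * c₀) k ℓ := by
  unfold ERLAtPhi; rw [h4]; congr 1; push_cast; ring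

/-- **Glue 3: S2 ⟹ (W-c)** with `ρ := n + 2c₁`. -/
theorem inRangeAtPhi_of_katz (h2 : KatzInRangeAtZero Gb n c₁ a) : InRangeAtPhi (cc Gb) ((n : ℤ) + 2 * c₁) a := by
  unfold InRangeAtPhi; rw [h2]; congr 1; push_cast; ring

/-- **The Δ-branch analytic triple from the finite-level decomposition** (all keys, `n = condExp (d % 2)`). -/
theorem analyticTriple_of_finiteLevel (h2 : KatzInRangeAtZero Gb n c₁ a) (h3 : FactorisationOnLine L Ga Gb)
    (h4 : PadicGZAtPhi L n c₀ k ℓ) (h5 : MatchAtZero Ga G0) :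
    ERLAtPhi (cc L) ((n : ℤ) + 2 * c₀) k ℓ ∧ FactorisationAtPhi G0 (cc L) (cc Gb) ∧
      InRangeAtPhi (cc Gb) ((n : ℤ) + 2 * c₁) a :=
  ⟨erlAtPhi_of_padicGZ h4, factorisationAtPhi_of_line h3 h5, inRangeAtPhi_of_katz h2⟩

/-- The explicit analytic column of `e_A`: `2ε − ρ = n(key) + (4c₀ − 2c₁)` — the key-dependence is the
conductor exponent ALONE (`2` on the odd-`d` keys, `3` on the even-`d` keys) if `c₀, c₁` are key-independent
(the card's falsifiable claim F1). -/
theorem two_eps_sub_rho (n : ℕ) (c₀ c₁ : ℤ) :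
    2 * ((n : ℤ) + 2 * c₀) - ((n : ℤ) + 2 * c₁) = n + (4 * c₀ - 2 * c₁) := by ring

theorem two_eps_sub_rho_odd (c₀ c₁ : ℤ) :
    2 * ((condExp 1 : ℤ) + 2 * c₀) - ((condExp 1 : ℤ) + 2 * c₁) = 2 + (4 * c₀ - 2 * c₁) := by simp; ring

theorem two_eps_sub_rho_even (c₀ c₁ : ℤ) :
    2 * ((condExp 0 : ℤ) + 2 * c₀) - ((condExp 0 : ℤ) + 2 * c₁) = 3 + (4 * c₀ - 2 * c₁) := by simp; ring

/-! ### §D  The ONE-SIDED (LOWER) chain: S3⁻ ∧ S4⁻ ∧ S2 ∧ S5 ⟹ a lower bound on `m = 2·ord₂ G0` (PROVED) -/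

/-- Norm bookkeeping: if `Ga·Gb = w·L²` on the line, `Ga(0) = unit·G0`, `‖G0‖ = 2^{sG}`, `‖Gb(0)‖ = 2^{sB}` and
`‖L(0)‖ ≤ 2^{sL}`, then `sG + sB ≤ 2 sL` (`‖w(0)‖ ≤ 1`).  Direction audit (B1): LOWER needs an UPPER bound on
`‖G0‖`, i.e. a LOWER bound on `−sG`, which is what this gives. -/
theorem exponent_le_of_divisibility (hdiv : DivisibilityOnLine L Ga Gb) (h5 : MatchAtZero Ga G0)
    {sG sB sL : ℝ} (hG0 : ‖G0‖ = (2 : ℝ) ^ sG) (hGb : ‖cc Gb‖ = (2 : ℝ) ^ sB) (hL : ‖cc L‖ ≤ (2 : ℝ) ^ sL) :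
    sG + sB ≤ 2 * sL := by
  obtain ⟨w, hw⟩ := hdiv
  obtain ⟨w₀, hw₀, hGa⟩ := h5
  have hcc : cc Ga * cc Gb = cc w * cc L ^ 2 := by
    have h := congrArg cc hw
    rwa [cc_mul, cc_mul, cc_pow] at h
  have hGa' : ‖cc Ga‖ = (2 : ℝ) ^ sG := by
    rw [hGa, norm_mul, isUnit_padicComplexInt_iff.mp hw₀, one_mul, hG0]
  have hprod : ‖cc Ga‖ * ‖cc Gb‖ ≤ ‖cc L‖ ^ 2 := by
    rw [← norm_mul, hcc, norm_mul, norm_pow]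
    exact mul_le_of_le_one_left (by positivity) (norm_cc_le_one w)
  have hL2 : ‖cc L‖ ^ 2 ≤ ((2 : ℝ) ^ sL) ^ 2 := by
    exact pow_le_pow_left₀ (norm_nonneg _) hL 2
  have key : (2 : ℝ) ^ (sG + sB) ≤ (2 : ℝ) ^ (2 * sL) := by
    rw [Real.rpow_add two_pos, ← hGa', ← hGb]
    have : ((2 : ℝ) ^ sL) ^ 2 = (2 : ℝ) ^ (2 * sL) := by
      rw [← Real.rpow_natCast, ← Real.rpow_mul (le_of_lt two_pos)]; congr 1; push_cast; ring
    rw [← this]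
    exact hprod.trans hL2
  exact (Real.rpow_le_rpow_left_iff one_lt_two).mp key

/-- **LOWER's analytic inequality per key** (the `a` of the partner cancels later against (W-d), k3-g3 §1.3):
`S3⁻ ∧ S5 ∧ S2 ∧ S4⁻ ⟹ m ≥ n + 4c₀ − 2c₁ − 2a + 4k + 4ℓ` where `‖G0‖ = 2^{−m/2}`. -/
theorem lower_m_bound (hdiv : DivisibilityOnLine L Ga Gb) (h5 : MatchAtZero Ga G0)
    (h2 : KatzInRangeAtZero Gb n c₁ a) (h4 : PadicGZLowerAtPhi L n c₀ k ℓ)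
    {m : ℤ} (hG0 : ‖G0‖ = (2 : ℝ) ^ (-(m : ℝ) / 2)) :
    (n : ℤ) + 4 * c₀ - 2 * c₁ - 2 * a + 4 * k + 4 * ℓ ≤ m := by
  have h := exponent_le_of_divisibility hdiv h5 hG0 h2 h4
  have h' : -(m : ℝ) / 2 + (-(n : ℝ) / 2 - c₁ - a) ≤ 2 * (-(n : ℝ) / 2 - c₀ - k - ℓ) := h
  have h'' : ((n : ℤ) : ℝ) + 4 * c₀ - 2 * c₁ - 2 * a + 4 * k + 4 * ℓ ≤ m := by
    push_cast; linarith
  exact_mod_cast h''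

/-- S3 ⟹ S3⁻ (Plan 1 ≥ Plan 1⁻): a unit factorisation gives divisibility with `w = u⁻¹`. -/
theorem divisibility_of_factorisation (h3 : FactorisationOnLine L Ga Gb) : DivisibilityOnLine L Ga Gb := by
  obtain ⟨u, hu, hL⟩ := h3
  obtain ⟨v, rfl⟩ := hu
  refine ⟨((v⁻¹ : (PowerSeries (PadicComplexInt 2))ˣ) : PowerSeries (PadicComplexInt 2)), ?_⟩
  rw [hL, ← mul_assoc, ← mul_assoc, Units.inv_mul, one_mul]

/-- S4 ⟹ S4⁻. -/
theorem padicGZLower_of_padicGZ (h4 : PadicGZAtPhi L n c₀ k ℓ) : PadicGZLowerAtPhi L n c₀ k ℓ :=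
  le_of_eq h4

end Summit.BirchSwinnertonDyer.BirchSwinnertonDyer.Cruxes.SplitBadTwoLowerHalfOfFacts.HeegnerIndexTwo.K3G5
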